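import Summits.AtomisticToContinuum.Crystallization.Theorems.FrustratedLawDichotomyStrainedPatchHomEntrySixHcp
import Summits.AtomisticToContinuum.Crystallization.Theorems.FrustratedLawDichotomyCellKitF

/-!
# The reflected (P2′) RADIAL-BAD prune on entry boxes: «some shell neighbour at `(9/8, 13/10)·d₀` ⟹ the centre is `1/8`-BAD ⟹ `PruneFcc U`»

decomp-a2c hand-1 g21 (crux `AperiodicFrustratedLawGap`, stmt-AtomisticToContinuum-27623; CERT-DESIGN-g44 §2 (P2) / hand-2 g22 «a (P3) prune only if the
census finds a gap between fit and floor regions»).  hand-1 g21's pilots show WHY this prune is needed regardless: both floor checkers cap the accepted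
entry half-width at `2⁻¹²` (table) / `2⁻⁹…2⁻⁸` (box) INDEPENDENTLY of the margin (structural: table row ranges; curvature terms), so the outer
region of the cube `‖U − 1‖ ≤ 1/4` — where the lattice is `1/8`-bad and the floor margin is huge — must be removed by a prune that works on COARSE
boxes.  The rotation-free radial obstruction of hand-1 g15 (`…CellKitF.not_goodAtScale_of_radial`: nearest-neighbour distance `d₀` pinned and a
point at distance in `[(1 + η)d₀, 13/10·d₀)` ⟹ not `η`-good for ANY isometry / assignment) gives exactly that:

* §1 ★ `pruneFcc_of_radialBad` (real side): lattice vectors `v, w` of `U·L_fcc` with `‖v‖ ≤ d₀ ≤ ‖u‖` for every non-zero lattice vector `u` and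
  `(9/8) d₀ ≤ ‖w‖ < (13/10) d₀`, `‖w‖ < 15/2` ⟹ the prune disjunct (`BadNearCap (9/5) (3/2)` at the centre);
* §2 label facts: the labels of fcc norm `1` are the twelve `K12`, of norm `2` the six `K6`, norm `0` only `b = 0`, and norm `≥ 3` vectors are longer
  than `5/4` (`≥ ¾√3`) hence never shorter than a first-shell vector;
* §3 ★ the kernel verdict `radOK c w` (squared lengths `q_b ∈ qformFI (gramT c w) b` of hand-2's kit): `Dhi/Dlo` = min over `K12` of the upper/lower
  ends, pin check `Dhi ≤ q_b.lo` for `b ∈ K6`, far witness `81·Dhi ≤ 64·q_b.lo ∧ 100·q_b.hi < 169·Dlo` for some `b ∈ K12 ++ K6`; ★★ `radOK_sound`;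
* §4 the verdicts `entryLeafOKR μ := radOK ∨ entryLeafOKD μ` (9-coordinate, fundamental domain) and `entryLeafOK6R μ := entryLeafOKR μ ∘ sym`, with
  ★★★ `homFloor_of_entrySearches6R` (+ `_625` / `_milli`).

0 sorry; standard axioms; no instances / notation / `#eval`.  `--supports stmt-AtomisticToContinuum-27623`.
-/

namespace Summit.AtomisticToContinuum.Crystallization.Theorems.FrustratedLawDichotomyStrainedPatchHomEntryRadial

open scoped BigOperators RealInnerProductSpace
open Literature.Analysis.ValidatedNumerics.Numerics
open Summit.AtomisticToContinuum.Crystallization.Theorems.ChargedEnergyGapNegative (E3)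
open Summit.AtomisticToContinuum.Crystallization.Theorems.FrustratedLawDichotomySchurCut (effPot w₄₅ ω₄)
open Summit.AtomisticToContinuum.Crystallization.Theorems.FrustratedLawDichotomyAveragingRuleTightFree (TightNearCap BadNearCap)
open Summit.AtomisticToContinuum.Crystallization.Theorems.FrustratedLawDichotomyAveragingCut (self_mem_ball)
open Summit.AtomisticToContinuum.Crystallization.Theorems.FrustratedLawDichotomyExemptAbsorption (ExemptNear)
open Summit.AtomisticToContinuum.Crystallization.Theorems.FrustratedLawDichotomyStrainedPatchHomSplit
open Summit.AtomisticToContinuum.Crystallization.Theorems.FrustratedLawDichotomyStrainedPatchHomPrunes (locHom_fcc_centre)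
open Summit.AtomisticToContinuum.Crystallization.Theorems.FrustratedLawDichotomyStrainedPatchHomPolar
  (norm_apply_le_of_norm_sub_one_le norm_apply_ge_of_norm_sub_one_le)
open Summit.AtomisticToContinuum.Crystallization.Theorems.FrustratedLawDichotomyStrainedPatchHomLeafTableCheck (nbZ norm_sq_fccComb)
open Summit.AtomisticToContinuum.Crystallization.Theorems.FrustratedLawDichotomyCellKitF (not_goodAtScale_of_radial)
open Summit.AtomisticToContinuum.Crystallization.Theorems.FrustratedLawDichotomyStrainedPatchHomPrunedPolar (homFloor_of_prunedBoxSums_selfAdjoint)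
open Summit.AtomisticToContinuum.Crystallization.Theorems.FrustratedLawDichotomyStrainedPatchHomCertTree (CertTree treeOK)
open Summit.AtomisticToContinuum.Crystallization.Theorems.FrustratedLawDichotomyStrainedPatchHomEntryGram
open Summit.AtomisticToContinuum.Crystallization.Theorems.FrustratedLawDichotomyStrainedPatchHomEntryFitKit (K12 qformFI gramT mem_normSq_latPt lmin lmin_le_of_mem lmin_mem)
open Summit.AtomisticToContinuum.Crystallization.Theorems.FrustratedLawDichotomyStrainedPatchHomEntryGramHcp (rootCH rootWH)
open Summit.AtomisticToContinuum.Crystallization.Theorems.FrustratedLawDichotomyStrainedPatchHomEntryTable (muRec muRec_ok)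
open Summit.AtomisticToContinuum.Crystallization.Theorems.FrustratedLawDichotomyStrainedPatchHomEntrySearch
open Summit.AtomisticToContinuum.Crystallization.Theorems.FrustratedLawDichotomyStrainedPatchHomEntrySign
open Summit.AtomisticToContinuum.Crystallization.Theorems.FrustratedLawDichotomyStrainedPatchHomEntrySix
open Summit.AtomisticToContinuum.Crystallization.Theorems.FrustratedLawDichotomyStrainedPatchHomEntrySixHcp
open Literature.Barriers.AtomisticToContinuum.FlatleyTheil2015 (fccVec)

/-! ## §1. The radial-bad prune (real side) -/

/-- ★ **RADIAL-BAD PRUNE.**  If `d₀` is the nearest-neighbour distance of the deformed lattice `U·L_fcc` (a lattice vector `v ≠ 0` with `‖v‖ ≤ d₀` and every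
non-zero lattice vector of length `≥ d₀`) and some lattice vector `w` has `(1 + 1/8) d₀ ≤ ‖w‖ < 13/10·d₀` (and `‖w‖ < 15/2`), then every realisation of the
`U`-fcc ball is pruned: its centre is not `1/8`-good at any scale (`…CellKitF.not_goodAtScale_of_radial`), i.e. `BadNearCap (9/5) (3/2)` holds. [folklore] -/
theorem pruneFcc_of_radialBad {U : E3 →L[ℝ] E3} {d₀ : ℝ} {bv bw : Fin 3 → ℤ} (hv0 : latPt U fccVec bv ≠ 0)
    (hvd : ‖latPt U fccVec bv‖ ≤ d₀) (hv7 : ‖latPt U fccVec bv‖ < 15 / 2)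
    (hpin : ∀ b : Fin 3 → ℤ, latPt U fccVec b ≠ 0 → d₀ ≤ ‖latPt U fccVec b‖)
    (hw1 : (1 + 1 / 8) * d₀ ≤ ‖latPt U fccVec bw‖) (hw2 : ‖latPt U fccVec bw‖ < 13 / 10 * d₀) (hw7 : ‖latPt U fccVec bw‖ < 15 / 2) :
    ∀ (M : ℕ) (z : Fin M → E3) (c : Fin M), Function.Injective z →
      Set.range z = {x : E3 | dist x (z c) ≤ 133 / 10 ∧ ∃ a : Fin 3 → ℤ, x = z c + latPt U fccVec a} →
      TightNearCap (9 / 5) (3 / 2) z c ∨ ExemptNear (9 / 5) ExRec z c ∨ BadNearCap (9 / 5) (3 / 2) z c := by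
  intro M z c _ hrange
  have hT := locHom_fcc_centre hrange
  refine Or.inr (Or.inr ⟨c, self_mem_ball (by norm_num) z c, not_goodAtScale_of_radial (d₀ := d₀) (by norm_num) ?_ ?_ ?_⟩)
  · -- pinning: every other point of the ball is a non-zero lattice vector away
    intro a hne
    have hmem : z a ∈ Set.range z := ⟨a, rfl⟩
    rw [hrange] at hmem
    obtain ⟨-, b, hb⟩ := hmem
    have hval : z a - z c = latPt U fccVec b := by rw [hb]; abel
    have hb0 : latPt U fccVec b ≠ 0 := by
      intro h0; apply hne; rw [← sub_eq_zero, hval, h0]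
    rw [dist_eq_norm, hval]
    exact hpin b hb0
  · -- the nearest neighbour `z c + v`
    have hx : z c + latPt U fccVec bv ∈ Set.range z :=
      (hT _ (by rwa [dist_eq_norm, add_sub_cancel_left])).2 ⟨bv, by rw [add_sub_cancel_left]⟩
    obtain ⟨a, ha⟩ := hx
    refine ⟨a, ?_, ?_⟩
    · intro h; apply hv0
      have := congrArg (fun x => x - z c) ha
      simpa [h] using this.symm
    · rw [dist_eq_norm, ha, add_sub_cancel_left]; exact hvd
  · -- the radially misplaced neighbour `z c + w`
    have hx : z c + latPt U fccVec bw ∈ Set.range z :=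
      (hT _ (by rwa [dist_eq_norm, add_sub_cancel_left])).2 ⟨bw, by rw [add_sub_cancel_left]⟩
    obtain ⟨a, ha⟩ := hx
    exact ⟨a, by rw [dist_eq_norm, ha, add_sub_cancel_left]; exact hw1, by rw [dist_eq_norm, ha, add_sub_cancel_left]; exact hw2⟩

/-! ## §2. Label facts -/

/-- The six labels of fcc norm `2` (the second, octahedral shell `‖v‖ = √2`). -/
def K6 : List (Fin 3 → ℤ) := [![1, 1, -1], ![1, -1, 1], ![-1, 1, 1], ![-1, -1, 1], ![-1, 1, -1], ![1, -1, -1]]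

/-- `12·n_b ≥ 8·b_k²` for each coordinate. [folklore] -/
theorem sq_le_nbZ (b : Fin 3 → ℤ) : 8 * (b 0 * b 0) ≤ 12 * nbZ b ∧ 8 * (b 1 * b 1) ≤ 12 * nbZ b ∧ 8 * (b 2 * b 2) ≤ 12 * nbZ b := by
  simp only [nbZ]
  refine ⟨?_, ?_, ?_⟩
  · nlinarith [sq_nonneg (2 * b 0 + 3 * (b 1 + b 2)), sq_nonneg (b 1 - b 2)]
  · nlinarith [sq_nonneg (2 * b 1 + 3 * (b 0 + b 2)), sq_nonneg (b 0 - b 2)]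
  · nlinarith [sq_nonneg (2 * b 2 + 3 * (b 0 + b 1)), sq_nonneg (b 0 - b 1)]

/-- ★ Classification of short labels: `n_b ≤ 2` ⟹ `b = 0`, or `n_b = 1 ∧ b ∈ K12`, or `n_b = 2 ∧ b ∈ K6`. [folklore] -/
theorem short_label_cases (b : Fin 3 → ℤ) (h : nbZ b ≤ 2) : b = 0 ∨ (nbZ b = 1 ∧ b ∈ K12) ∨ (nbZ b = 2 ∧ b ∈ K6) := by
  obtain ⟨h0, h1, h2⟩ := sq_le_nbZ b
  have e : b = ![b 0, b 1, b 2] := by funext i; fin_cases i <;> rfl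
  have a0 : -1 ≤ b 0 := by nlinarith
  have a0' : b 0 ≤ 1 := by nlinarith
  have a1 : -1 ≤ b 1 := by nlinarith
  have a1' : b 1 ≤ 1 := by nlinarith
  have a2 : -1 ≤ b 2 := by nlinarith
  have a2' : b 2 ≤ 1 := by nlinarith
  rw [e] at h ⊢
  simp only [nbZ, Matrix.cons_val_zero, Matrix.cons_val_one, Matrix.cons_val] at h ⊢
  interval_cases (b 0) <;> interval_cases (b 1) <;> interval_cases (b 2) <;> simp_all [K12, K6]

/-- A label of fcc norm `≥ 3` is longer than `5/4` under `‖U − 1‖ ≤ 1/4` (`‖U v‖ ≥ ¾‖v‖ = ¾√n_b ≥ ¾√3 > 5/4`). [folklore] -/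
theorem norm_latPt_gt_of_nbZ_ge_three {U : E3 →L[ℝ] E3} (hU : ‖U - 1‖ ≤ 1 / 4) {b : Fin 3 → ℤ} (hb : 3 ≤ nbZ b) :
    5 / 4 < ‖latPt U fccVec b‖ := by
  unfold latPt
  have h1 := norm_apply_ge_of_norm_sub_one_le hU (∑ i : Fin 3, ((b i : ℤ) : ℝ) • fccVec i)
  have hsq := norm_sq_fccComb b
  have h3 : (3 : ℝ) ≤ ‖∑ i : Fin 3, ((b i : ℤ) : ℝ) • fccVec i‖ ^ 2 := by rw [hsq]; exact_mod_cast hb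
  nlinarith [norm_nonneg (∑ i : Fin 3, ((b i : ℤ) : ℝ) • fccVec i), norm_nonneg (U (∑ i : Fin 3, ((b i : ℤ) : ℝ) • fccVec i))]

/-- A first-shell vector is at most `5/4` long under `‖U − 1‖ ≤ 1/4`. [folklore] -/
theorem norm_latPt_le_of_mem_K12 {U : E3 →L[ℝ] E3} (hU : ‖U - 1‖ ≤ 1 / 4) {b : Fin 3 → ℤ} (hb : b ∈ K12) : ‖latPt U fccVec b‖ ≤ 5 / 4 := by
  unfold latPt
  have h1 := norm_apply_le_of_norm_sub_one_le hU (∑ i : Fin 3, ((b i : ℤ) : ℝ) • fccVec i)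
  have hsq := norm_sq_fccComb b
  have hn : nbZ b = 1 := by
    simp only [K12, List.mem_cons, List.mem_nil_iff, or_false] at hb
    rcases hb with rfl | rfl | rfl | rfl | rfl | rfl | rfl | rfl | rfl | rfl | rfl | rfl <;> decide
  have hone : ‖∑ i : Fin 3, ((b i : ℤ) : ℝ) • fccVec i‖ = 1 := by
    have : ‖∑ i : Fin 3, ((b i : ℤ) : ℝ) • fccVec i‖ ^ 2 = 1 := by rw [hsq, hn]; norm_num
    nlinarith [norm_nonneg (∑ i : Fin 3, ((b i : ℤ) : ℝ) • fccVec i)]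
  rw [hone] at h1; linarith

/-- `latPt U fccVec 0 = 0`. [formal bookkeeping] -/
theorem latPt_zero_label (U : E3 →L[ℝ] E3) : latPt U fccVec 0 = 0 := by simp [latPt]

/-! ## §3. The kernel verdict and its soundness -/

/-- ★ **THE RADIAL-BAD VERDICT** on an entry box: with `q_b = qformFI (gramT c w) b ∋ ‖latPt U f b‖²`, `Dhi = min_{K12} q.hi ≥ d₀²·SC`,
`Dlo = min_{K12} q.lo ≤ d₀²·SC`: the second shell is not shorter than `d₀` (`Dhi ≤ q_b.lo`, `b ∈ K6`) and some `b ∈ K12 ++ K6` is radially misplaced,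
`(81/64)·Dhi ≤ q_b.lo` and `q_b.hi < (169/100)·Dlo`. -/
def radOK (c w : Fin 3 × Fin 3 → ℤ) : Bool :=
  K6.all (fun b => decide (lmin (K12.map fun k => (qformFI (gramT c w) k).hi) ≤ (qformFI (gramT c w) b).lo)) &&
  (K12 ++ K6).any (fun b => decide (81 * lmin (K12.map fun k => (qformFI (gramT c w) k).hi) ≤ 64 * (qformFI (gramT c w) b).lo) &&
    decide (100 * (qformFI (gramT c w) b).hi < 169 * lmin (K12.map fun k => (qformFI (gramT c w) k).lo)))

/-- ★★ **SOUNDNESS OF THE RADIAL-BAD VERDICT**: `radOK c w = true` ⟹ the prune disjunct for every `U` with `‖U − 1‖ ≤ 1/4` and entries in the box.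
[folklore] -/
theorem radOK_sound {c w : Fin 3 × Fin 3 → ℤ} (h : radOK c w = true) (U : E3 →L[ℝ] E3) (hU : ‖U - 1‖ ≤ 1 / 4)
    (hbox : ∀ ab : Fin 3 × Fin 3, |(U (EuclideanSpace.single ab.2 (1 : ℝ))) ab.1 - (c ab : ℝ) / SC| ≤ (w ab : ℝ) / SC) :
    ∀ (M : ℕ) (z : Fin M → E3) (c : Fin M), Function.Injective z →
      Set.range z = {x : E3 | dist x (z c) ≤ 133 / 10 ∧ ∃ a : Fin 3 → ℤ, x = z c + latPt U fccVec a} →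
      TightNearCap (9 / 5) (3 / 2) z c ∨ ExemptNear (9 / 5) ExRec z c ∨ BadNearCap (9 / 5) (3 / 2) z c := by
  classical
  have hS := SC_pos
  simp only [radOK, Bool.and_eq_true, List.all_eq_true, List.any_eq_true, decide_eq_true_eq] at h
  obtain ⟨hpin6, bw, hbw, hw1, hw2⟩ := h
  set q : (Fin 3 → ℤ) → FI := fun b => qformFI (gramT c w) b with hq
  have hmem : ∀ b, FI.mem (‖latPt U fccVec b‖ ^ 2) (q b) := fun b => mem_normSq_latPt U hbox b
  -- the nearest first-shell neighbour `bv` and `d₀`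
  have hne : (K12.toFinset : Finset (Fin 3 → ℤ)).Nonempty := ⟨![0, 0, 1], by simp [K12]⟩
  obtain ⟨bv, hbv, hmin⟩ := K12.toFinset.exists_min_image (fun b => ‖latPt U fccVec b‖) hne
  rw [List.mem_toFinset] at hbv
  set d₀ := ‖latPt U fccVec bv‖ with hd₀
  have hmin' : ∀ k ∈ K12, d₀ ≤ ‖latPt U fccVec k‖ := fun k hk => hmin k (List.mem_toFinset.2 hk)
  -- `Dlo ≤ d₀² SC ≤ Dhi`
  have hDlo : ((lmin (K12.map fun k => (q k).lo) : ℤ) : ℝ) ≤ d₀ ^ 2 * SC := by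
    have hle := lmin_le_of_mem (K12.map fun k => (q k).lo) (q bv).lo (List.mem_map.2 ⟨bv, hbv, rfl⟩)
    have := (hmem bv).1
    calc ((lmin (K12.map fun k => (q k).lo) : ℤ) : ℝ) ≤ (q bv).lo := by exact_mod_cast hle
      _ ≤ d₀ ^ 2 * SC := this
  have hDhi : d₀ ^ 2 * SC ≤ ((lmin (K12.map fun k => (q k).hi) : ℤ) : ℝ) := by
    have hm := lmin_mem (K12.map fun k => (q k).hi) (by simp [K12])
    obtain ⟨k₁, hk₁, hk₁e⟩ := List.mem_map.1 hm
    rw [← hk₁e]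
    have h2 := (hmem k₁).2
    have hdk : d₀ ≤ ‖latPt U fccVec k₁‖ := hmin' k₁ hk₁
    have : d₀ ^ 2 ≤ ‖latPt U fccVec k₁‖ ^ 2 := pow_le_pow_left₀ (norm_nonneg _) hdk 2
    nlinarith
  have hd0 : 0 ≤ d₀ := norm_nonneg _
  have hdle : d₀ ≤ 5 / 4 := norm_latPt_le_of_mem_K12 hU hbv
  -- the nearest neighbour is non-zero and `d₀ > 0`
  have hv1 : 3 / 4 ≤ d₀ := by
    have h1 := norm_apply_ge_of_norm_sub_one_le hU (∑ i : Fin 3, ((bv i : ℤ) : ℝ) • fccVec i)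
    have hsq := norm_sq_fccComb bv
    have hn : nbZ bv = 1 := by
      simp only [K12, List.mem_cons, List.mem_nil_iff, or_false] at hbv
      rcases hbv with rfl | rfl | rfl | rfl | rfl | rfl | rfl | rfl | rfl | rfl | rfl | rfl <;> decide
    have hone : ‖∑ i : Fin 3, ((bv i : ℤ) : ℝ) • fccVec i‖ = 1 := by
      have : ‖∑ i : Fin 3, ((bv i : ℤ) : ℝ) • fccVec i‖ ^ 2 = 1 := by rw [hsq, hn]; norm_num
      nlinarith [norm_nonneg (∑ i : Fin 3, ((bv i : ℤ) : ℝ) • fccVec i)]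
    rw [hone] at h1
    have : latPt U fccVec bv = U (∑ i : Fin 3, ((bv i : ℤ) : ℝ) • fccVec i) := rfl
    rw [hd₀, this]; linarith
  have hv0 : latPt U fccVec bv ≠ 0 := by
    intro h0; rw [hd₀, h0, norm_zero] at hv1; linarith
  -- pinning of ALL non-zero lattice vectors
  have hpin : ∀ b : Fin 3 → ℤ, latPt U fccVec b ≠ 0 → d₀ ≤ ‖latPt U fccVec b‖ := by
    intro b hb0
    by_cases h3 : 3 ≤ nbZ b
    · exact hdle.trans (norm_latPt_gt_of_nbZ_ge_three hU h3).le
    · rcases short_label_cases b (by omega) with rfl | ⟨-, hK⟩ | ⟨-, hK⟩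
      · exact (hb0 (latPt_zero_label U)).elim
      · exact hmin' b hK
      · -- second shell: `Dhi ≤ q_b.lo`
        have hle : ((lmin (K12.map fun k => (q k).hi) : ℤ) : ℝ) ≤ ((q b).lo : ℝ) := by exact_mod_cast hpin6 b hK
        have h1 := (hmem b).1
        have hsq : d₀ ^ 2 ≤ ‖latPt U fccVec b‖ ^ 2 :=
          le_of_mul_le_mul_right (hDhi.trans (hle.trans h1)) hS
        exact (abs_le_of_sq_le_sq' hsq (norm_nonneg _)).2
  -- the radially misplaced neighbour `bw`
  have hw_lo : (1 + 1 / 8) * d₀ ≤ ‖latPt U fccVec bw‖ := by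
    have h1 := (hmem bw).1
    have e1 : (81 : ℝ) * ((lmin (K12.map fun k => (q k).hi) : ℤ) : ℝ) ≤ 64 * ((q bw).lo : ℝ) := by exact_mod_cast hw1
    have h3 : (81 / 64 * d₀ ^ 2) * SC ≤ ‖latPt U fccVec bw‖ ^ 2 * SC := by nlinarith
    have hsq : ((1 + 1 / 8) * d₀) ^ 2 ≤ ‖latPt U fccVec bw‖ ^ 2 := by
      have := le_of_mul_le_mul_right h3 hS
      nlinarith
    exact (abs_le_of_sq_le_sq' hsq (norm_nonneg _)).2
  have hw_hi : ‖latPt U fccVec bw‖ < 13 / 10 * d₀ := by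
    have h2 := (hmem bw).2
    have e1 : (100 : ℝ) * ((q bw).hi : ℝ) < 169 * ((lmin (K12.map fun k => (q k).lo) : ℤ) : ℝ) := by exact_mod_cast hw2
    have h3 : ‖latPt U fccVec bw‖ ^ 2 * SC < (169 / 100 * d₀ ^ 2) * SC := by nlinarith
    have hsq : ‖latPt U fccVec bw‖ ^ 2 < (13 / 10 * d₀) ^ 2 := by
      have := lt_of_mul_lt_mul_right h3 hS.le
      nlinarith
    exact (abs_lt_of_sq_lt_sq' hsq (by linarith)).2
  exact pruneFcc_of_radialBad hv0 le_rfl (by linarith) hpin hw_lo hw_hi (by linarith)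

/-! ## §4. Verdicts with the radial prune and the `(H)` theorems -/

/-- ★ **ENTRY-LEAF VERDICT WITH THE RADIAL PRUNE** (fundamental domain): radial-bad ∨ `entryLeafOKD μ` (sign ∨ sort ∨ fit ∨ symmetry ∨ column ∨ table). -/
def entryLeafOKR (μ : ℤ) (c w : Fin 3 × Fin 3 → ℤ) : Bool := radOK c w || entryLeafOKD μ c w

/-- ★ Soundness of `entryLeafOKR` in the domain-relativised `hver` shape. [folklore] -/
theorem entryLeafOKR_sound {μ : ℤ} {c w : Fin 3 × Fin 3 → ℤ} (h : entryLeafOKR μ c w = true) (U : E3 →L[ℝ] E3)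
    (hsa : ∀ v v' : E3, ⟪U v, v'⟫ = ⟪v, U v'⟫) (hU : ‖U - 1‖ ≤ 1 / 4)
    (hbox : ∀ ab : Fin 3 × Fin 3, |(U (EuclideanSpace.single ab.2 (1 : ℝ))) ab.1 - (c ab : ℝ) / SC| ≤ (w ab : ℝ) / SC)
    (h1 : (U (EuclideanSpace.single 1 (1 : ℝ))) 1 ≤ (U (EuclideanSpace.single 0 (1 : ℝ))) 0)
    (h2 : (U (EuclideanSpace.single 2 (1 : ℝ))) 2 ≤ (U (EuclideanSpace.single 1 (1 : ℝ))) 1)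
    (h01 : 0 ≤ (U (EuclideanSpace.single 1 (1 : ℝ))) 0) (h02 : 0 ≤ (U (EuclideanSpace.single 2 (1 : ℝ))) 0) :
    (∀ (M : ℕ) (z : Fin M → E3) (c : Fin M), Function.Injective z →
        Set.range z = {x : E3 | dist x (z c) ≤ 133 / 10 ∧ ∃ a : Fin 3 → ℤ, x = z c + latPt U fccVec a} →
        TightNearCap (9 / 5) (3 / 2) z c ∨ ExemptNear (9 / 5) ExRec z c ∨ BadNearCap (9 / 5) (3 / 2) z c) ∨
      (μ : ℝ) / SC ≤ ∑ b ∈ (Fintype.piFinset fun _ : Fin 3 => Finset.Icc (-7 : ℤ) 7).filter (fun b => b ≠ 0),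
        effPot w₄₅ ω₄ (3 / 400) ‖latPt U fccVec b‖ := by
  simp only [entryLeafOKR, Bool.or_eq_true] at h
  rcases h with h | h
  · exact Or.inl (radOK_sound h U hU hbox)
  · exact entryLeafOKD_sound h U hsa hU hbox h1 h2 h01 h02

/-- ★ **SIX-COORDINATE VERDICT WITH THE RADIAL PRUNE**: `entryLeafOKR μ` on the symmetrised box. -/
def entryLeafOK6R (μ : ℤ) (c w : Fin 3 × Fin 3 → ℤ) : Bool := entryLeafOKR μ (c ∘ symIdx) (w ∘ symIdx)

/-- ★★ The fcc half from one six-coordinate search with the radial prune. [folklore] -/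
theorem fccHalf_of_entrySearch6R {m : ℝ} {μ : ℤ} (hμ : 2 * (m + (-(7175 / 10000) + 3 / 400)) * SC ≤ μ)
    {sel : ℕ → (Fin 3 × Fin 3 → ℤ) → (Fin 3 × Fin 3 → ℤ) → Fin 3 × Fin 3} {fuel d : ℕ}
    (h : searchOK (entryLeafOK6R μ) sel fuel d rootC rootW = true) :
    ∀ U : E3 →L[ℝ] E3, (∀ v w : E3, inner ℝ (U v) w = inner ℝ v (U w)) → (∀ w : E3, 0 ≤ inner ℝ w (U w)) → ‖U - 1‖ ≤ 1 / 4 →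
      (∀ (M : ℕ) (z : Fin M → E3) (c : Fin M), Function.Injective z →
          Set.range z = {x : E3 | dist x (z c) ≤ 133 / 10 ∧ ∃ a : Fin 3 → ℤ, x = z c + latPt U fccVec a} →
          TightNearCap (9 / 5) (3 / 2) z c ∨ ExemptNear (9 / 5) ExRec z c ∨ BadNearCap (9 / 5) (3 / 2) z c) ∨
      m ≤ (∑ b ∈ (Fintype.piFinset fun _ : Fin 3 => Finset.Icc (-7 : ℤ) 7).filter (fun b => b ≠ 0),
        effPot w₄₅ ω₄ (3 / 400) ‖latPt U fccVec b‖) / 2 - (-(7175 / 10000) + 3 / 400) := by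
  obtain ⟨t, ht⟩ := exists_tree_of_searchOK (entryLeafOK6R μ) sel fuel d rootC rootW h
  exact fccHalf_of_entryTreeDom hμ (entryLeafOK6R μ)
    (sym_hver (entryLeafOKR μ) fun c w hv U hsa hU hbox h1 h2 h01 h02 => entryLeafOKR_sound hv U hsa hU hbox h1 h2 h01 h02) ht

/-- ★★★ **`(H) HomFloor m` FROM TWO REDUCED SEARCHES WITH THE RADIAL PRUNE** (fcc: `entryLeafOK6R`, hcp: `entryLeafOKH6`). [folklore] -/
theorem homFloor_of_entrySearches6R {m : ℝ} {μ : ℤ} (hμ : 2 * (m + (-(7175 / 10000) + 3 / 400)) * SC ≤ μ)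
    {selF : ℕ → (Fin 3 × Fin 3 → ℤ) → (Fin 3 × Fin 3 → ℤ) → Fin 3 × Fin 3} {fuelF dF : ℕ}
    (hF : searchOK (entryLeafOK6R μ) selF fuelF dF rootC rootW = true)
    {selH : ℕ → ((Fin 3 × Fin 3) ⊕ Fin 3 → ℤ) → ((Fin 3 × Fin 3) ⊕ Fin 3 → ℤ) → (Fin 3 × Fin 3) ⊕ Fin 3} {fuelH dH : ℕ}
    (hH : searchOK (entryLeafOKH6 μ) selH fuelH dH rootCH rootWH = true) : HomFloor m :=
  homFloor_of_prunedBoxSums_selfAdjoint (fccHalf_of_entrySearch6R hμ hF) (hcpHalf_of_entrySearchH6 hμ hH)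

/-- ★★★ `HomFloor (1/625)` with the radial prune. [folklore] -/
theorem homFloor_625_of_entrySearches6R
    {selF : ℕ → (Fin 3 × Fin 3 → ℤ) → (Fin 3 × Fin 3 → ℤ) → Fin 3 × Fin 3} {fuelF dF : ℕ}
    (hF : searchOK (entryLeafOK6R muRec) selF fuelF dF rootC rootW = true)
    {selH : ℕ → ((Fin 3 × Fin 3) ⊕ Fin 3 → ℤ) → ((Fin 3 × Fin 3) ⊕ Fin 3 → ℤ) → (Fin 3 × Fin 3) ⊕ Fin 3} {fuelH dH : ℕ}
    (hH : searchOK (entryLeafOKH6 muRec) selH fuelH dH rootCH rootWH = true) : HomFloor (1 / 625) :=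
  homFloor_of_entrySearches6R muRec_ok hF hH

/-- ★★★ `HomFloor (1/1000)` with the radial prune. [folklore] -/
theorem homFloor_milli_of_entrySearches6R
    {selF : ℕ → (Fin 3 × Fin 3 → ℤ) → (Fin 3 × Fin 3 → ℤ) → Fin 3 × Fin 3} {fuelF dF : ℕ}
    (hF : searchOK (entryLeafOK6R muMilli) selF fuelF dF rootC rootW = true)
    {selH : ℕ → ((Fin 3 × Fin 3) ⊕ Fin 3 → ℤ) → ((Fin 3 × Fin 3) ⊕ Fin 3 → ℤ) → (Fin 3 × Fin 3) ⊕ Fin 3} {fuelH dH : ℕ}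
    (hH : searchOK (entryLeafOKH6 muMilli) selH fuelH dH rootCH rootWH = true) : HomFloor (1 / 1000) :=
  homFloor_of_entrySearches6R muMilli_ok hF hH

/-! ## §5. Kernel smoke tests -/

/-- The radial prune FIRES on the box of entry half-width `2⁻¹²` around the sheared lattice `diag(1.15, 1, 0.87)` (first-shell length ratio `≈ 1.15 ∈
(9/8, 13/10)`; ratio margin 2 %) and on the box of half-width `2⁻¹⁰` around the 20 % uniaxially compressed lattice `diag(0.8, 1, 1)` (second-shell
neighbour at `≈ 1.25·d₀`), and does NOT fire at the identity.  LIMITATION (measured by these literals): the enclosure `qformFI ∘ gramT` has width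
≈ `16–36 ×` the entry half-width, so the prune needs entry half-width ≲ 2⁻⁹…2⁻¹⁰ unless the ratio is far inside `(9/8, 13/10)`; a cancellation-free
evaluation about the nominal scale (as in `…HomEntryFit.kissSq`) would buy ≈ ×4 wider boxes — successor work. -/
example : radOK (fun ab => if ab.1 = ab.2 then (if ab.1 = 0 then 323696223217254 else if ab.1 = 1 then 281474976710656 else 244883729738271) else 0)
      (fun _ => 68719476736) = true ∧
    radOK (fun ab => if ab.1 = ab.2 then (if ab.1 = 0 then 225179981368525 else 281474976710656) else 0) (fun _ => 274877906944) = true ∧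
    radOK rootC (fun _ => 0) = false := by
  decide +kernel

end Summit.AtomisticToContinuum.Crystallization.Theorems.FrustratedLawDichotomyStrainedPatchHomEntryRadial
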